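import Mathlib
import HarnessLib
import Literature.Probability.Percolation.QuadCrossingSpace
import Literature.Probability.LatticeModels.IsoradialPercolation
import Literature.Probability.LatticeModels.IsoradialGraphs
import Literature.Probability.Percolation.SelfRefinementMeasure

/-!
# Sketch — first lemmas of the crux idea cards of ideator 2 (round 1) for
`TrivialSectorRate` (stmt-CriticalPhenomena-10266, route CardySelfRefinement).

* `OrientationMemoryFiveArm` — card `six-minus-five` (messenger-arm memory bound, first order):
  on plain bond-ℤ² at `p = 1/2` (the endpoint `s = 1` of the path) the pivotal probabilities of the
  horizontal and of the vertical edge at the same vertex, for the same joint quad-crossing event,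
  differ by at most a constant times the polychromatic FIVE-arm probability over the scales between
  the edge and the quads' boundaries.
* `QuenchedDisintegration`, `TieDisorderVariance` — card `quenched-hypergraph-harris`:
  `M_k(ρ,c)` is the average over i.i.d.(ρ) tie patterns `T` of PRODUCT measures (Bernoulli
  percolation on the planar hypergraph obtained by fusing the tied tuples), and the quenched
  fluctuation of any event's probability is controlled by an Efron–Stein sum of tie-responses.

Nothing here is proved; the defs only have to elaborate.
-/

noncomputable section

namespace Summit.CriticalPhenomena.CardyFormulaZ2.Cruxes.TrivialSectorRate.Ideator2

open Literature.Probability.Percolation Literature.Probability.LatticeModels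
open Literature.Probability.Percolation.QuadCrossing
open MeasureTheory Set

/-- The joint crossing event of the quad family `F` at mesh `η` (the crux's `A m F η`). -/
def jointCrossing (m : ℕ) (F : Fin m → Quad (univ : Set ℂ)) (η : ℝ) : Set (BondConfig (Site 2)) :=
  {ω | ∀ i, F i ∈ configOf squareLatticeEmbedding.z η univ ω}

/-- Pivotality of the edge `e` for an increasing event `A`. -/
def pivotal (e : Sym2 (Site 2)) (A : Set (BondConfig (Site 2))) : Set (BondConfig (Site 2)) :=
  {ω | insert e ω ∈ A ∧ ω \ {e} ∉ A}

/-- The five-arm colour sequence (open, closed, open, open, closed) of Nolin 2008 Thm 23. -/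
def kappa5 : Fin 5 → Bool := ![true, false, true, true, false]

/-- The critical bond measure on `ℤ²`. -/
abbrev Pz2 : Measure (BondConfig (Site 2)) := bondPercolation (zdGraph 2) half

/-- **Card `six-minus-five`, first lemma (orientation memory ≤ five-arm cost).**
For every finite quad family there are `C, η₀` such that for every mesh `η < η₀`, every vertex `v`
and every `R ≥ 2` with the ball of radius `ηR` about `ηv` disjoint from all quad boundaries,
`|P(h-edge at v pivotal) − P(v-edge at v pivotal)| ≤ C · P(5 polychromatic arms from radius 2 to R)`.
On ℤ² the right side is `≍ R⁻²` (Nolin 2008 Thm 23 / Rem 25), i.e. the two pivotal probabilities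
(each `≍ (1/R)^{α₄}·O(1)`) agree to RELATIVE order `R^{-(2-α₄)}` — the marginal threshold of the crux. -/
def OrientationMemoryFiveArm : Prop :=
  ∀ (m : ℕ) (F : Fin m → Quad (univ : Set ℂ)), ∃ C η₀ : ℝ, 0 < η₀ ∧
    ∀ η ∈ Ioo (0 : ℝ) η₀, ∀ (v : Site 2) (R : ℕ), 2 ≤ R →
      (∀ i, Disjoint (Metric.ball ((η : ℂ) * squareLatticeEmbedding.z v) (η * R))
        (frontier (range (F i)))) →
      |Pz2.real (pivotal (cornerEdge (v, 0)) (jointCrossing m F η)) -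
          Pz2.real (pivotal (cornerEdge (v, 1)) (jointCrossing m F η))|
        ≤ C * Pz2.real (squareLatticeEmbedding.embArmEvent kappa5 2 R)

open Classical in
/-- Quenched coin parameters: the selector of tuple `t` is frozen to `1` if `t ∈ T`, to `0`
otherwise; own and shared coins as in `refinementParam` (they do not depend on `ρ`). -/
def quenchedParam (k : ℕ) (T : Set (Site 2 × Fin 2)) (c : ℝ) (i : Site 2 × Fin 2 × Fin 3) :
    unitInterval :=
  if i.2.2 = 2 then (if (i.1, i.2.1) ∈ T then 1 else 0) else refinementParam k 0 c i

/-- The quenched measure `M_k^T(c)`: Bernoulli percolation in which the tuples of `T` are fused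
(one fair coin each), the other axial sub-edges are i.i.d. fair and interior edges are
Bernoulli(`c`) — a PRODUCT measure pushed through `refinementConfig`. -/
def quenchedMeasure (k : ℕ) (T : Set (Site 2 × Fin 2)) (c : ℝ) : Measure (BondConfig (Site 2)) :=
  (prodBernoulli (quenchedParam k T c)).map (refinementConfig k)

/-- The law of the tie pattern: i.i.d. Bernoulli(`ρ`) over tuples. -/
def tieLaw (ρ : ℝ) : Measure (Set (Site 2 × Fin 2)) :=
  prodBernoulli fun _ => projIcc (0 : ℝ) 1 zero_le_one ρ

/-- **Card `quenched-hypergraph-harris`, first lemma (a): exact disintegration.**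
`M_k(ρ,c)` is the `tieLaw ρ`-average of the quenched product measures. -/
def QuenchedDisintegration : Prop :=
  ∀ (k : ℕ) (ρ c : ℝ), selfRefinementMeasure k ρ c = (tieLaw ρ).bind fun T => quenchedMeasure k T c

/-- **Card `quenched-hypergraph-harris`, first lemma (b): Efron–Stein control of the tie disorder.**
The quenched probability of any event fluctuates around the annealed one by at most
`ρ(1-ρ) · sup_b |D_b| · Σ_b E|D_b|`, where `D_b` is the response to fusing / unfusing the single
tuple `b` (whenever the response sum converges). -/
def TieDisorderVariance : Prop :=
  ∀ (k : ℕ) (ρ c : ℝ), ρ ∈ Icc (0 : ℝ) 1 → ∀ A : Set (BondConfig (Site 2)), MeasurableSet A →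
    let q : Set (Site 2 × Fin 2) → ℝ := fun T => (quenchedMeasure k T c).real A
    let D : Site 2 × Fin 2 → Set (Site 2 × Fin 2) → ℝ := fun b T => q (insert b T) - q (T \ {b})
    Summable (fun b => ∫ T, |D b T| ∂(tieLaw ρ)) →
      ∫ T, (q T - (selfRefinementMeasure k ρ c).real A) ^ 2 ∂(tieLaw ρ)
        ≤ ρ * (1 - ρ) * (⨆ p : (Site 2 × Fin 2) × Set (Site 2 × Fin 2), |D p.1 p.2|)
          * ∑' b, ∫ T, |D b T| ∂(tieLaw ρ)

end Summit.CriticalPhenomena.CardyFormulaZ2.Cruxes.TrivialSectorRate.Ideator2
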